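import Literature.NumberTheory.Transcendental.Hyperlogarithms
import HarnessLib

/-!
# Hyperlogarithms on `(0,1)`, X: differentiation with respect to moving letters

Tenth layer of the analytic road to `GenusZeroPeriodsMZV` (Brown 2009): the dependence of the
positive hyperlogarithms `L_w(b; σ) = Hyperlog.hlog σ w b` of layer I on the POSITIONS of the
letters. For a one-parameter family `y ↦ σ_y` of admissible alphabets (letters at `0` fixed,
the other letters `≥ 1` moving differentiably, distinct letters having distinct values) we PROVE
Goncharov's differential formula in positive-density conventions
(`Hyperlog.hasDerivAt_hlog_family`):

  `∂_y L_{a_n ⋯ a_1}(b) = Σ_i L_{⋯ â_i ⋯}(b) · (Λ(a_i, a_{i-1}) - Λ(a_i, a_{i+1}))`,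

`a_0 :=` the base point `0`, `a_{n+1} :=` the end-point `b`, with the pairings
`Λ(c,c') = (σ'_c + ε_c σ'_{c'})/(σ_c - σ_{c'})` (`Hyperlog.lam`; `ε_c = ±1` the sign of the density
`1/|t-σ_c| = ε_c/(t-σ_c)`), `Λ(c, 0) = σ'_c/σ_c` (`lamBase`), `Λ(c, b) = σ'_c/|b-σ_c|` (`lamEnd`),
collected in the deletion sum `Hyperlog.Dhlog σ σ' w b` [Goncharov 1998, Thm 2.1; Brown 2009, §5.1
and §6 (the `σ_i` as coordinates on `𝔐_{0,n}`)]. The proof is by induction on the word: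
`L_{cu}(b) = ∫₀ᵇ L_u(t) dt/|t-σ_c|` is differentiated under the integral sign (the integrand is
bounded uniformly in the parameter, `abs_Dhlog_le`, from the bounds of layer I), and the integral
of the differentiated integrand is identified with `D_{cu}(b)` through the fundamental theorem of
calculus from the base point (`integral_eq_of_hasDerivAt_of_tendsto_zero`) and the DIFFERENTIAL
form of the inductive step (`hasDerivAt_Dhlog_cons`), whose heart is the three-term identity
`Λ(c,a)/|t-σ_a| - Λ(a,c)/|t-σ_c| = (σ'_c - σ'_a)/(|t-σ_c||t-σ_a|)` (`lam_mul_pden_sub`: partial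
fractions and integration by parts in one). Deletions producing words irregular at `0` come with
identically vanishing coefficients (`lamIn_nil_sub_lam_eq_zero`). No named fact is introduced.

## References

* F. C. S. Brown, *Multiple zeta values and periods of moduli spaces `𝔐̄_{0,n}`*, Ann. Sci. Éc.
  Norm. Supér. (4) 42 (2009), 371–489, §5.1, §6.1. doi:10.24033/asens.2099. [BrownENS2009]
* A. B. Goncharov, *Multiple polylogarithms, cyclotomy and modular complexes*, Math. Res. Lett.
  5 (1998), 497–516, Thm 2.1 (the differential equation of `I(a_0; a_1, …, a_n; a_{n+1})`).
-/

noncomputable section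

open MeasureTheory intervalIntegral Set Filter
open scoped BigOperators Topology Interval

namespace Literature.NumberTheory.Transcendental

namespace Hyperlog

variable {α : Type*}

/-! ### The pairing coefficients and the derivative sum -/

section DerivSum

/-- The sign `ε_c` of the positive density `1/|t - σ_c| = ε_c/(t - σ_c)` on `(0,1)`:
`+1` for a letter at `0`, `-1` for a letter in `[1,∞)`. [folklore] -/
def lsign (σ : α → ℝ) (c : α) : ℝ := if σ c = 0 then 1 else -1

/-- **The pairing** `Λ(c, c')` of a deleted letter `c` with a neighbour `c'` (Goncharov's
`d log(a_c - a_{c'})` in positive conventions): `(σ'_c + ε_c σ'_{c'})/(σ_c - σ_{c'})`, and `0` for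
equal values. [folklore] -/
def lam (σ σ' : α → ℝ) (c c' : α) : ℝ :=
  if σ c = σ c' then 0 else (σ' c + lsign σ c * σ' c') / (σ c - σ c')

/-- The pairing of a deleted letter with the base point `0`: `σ'_c/σ_c` (`0` for a letter at `0`).
[folklore] -/
def lamBase (σ σ' : α → ℝ) (c : α) : ℝ := if σ c = 0 then 0 else σ' c / σ c

/-- The pairing of the outermost letter with the end-point `b`: `σ'_c/|b - σ_c|` (`σ'_c = 0` for
letters at `0`). [folklore] -/
def lamEnd (σ σ' : α → ℝ) (c : α) (b : ℝ) : ℝ := σ' c * pden σ c b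

/-- The inner pairing of a deleted letter `a` whose inner remainder is `u`. [folklore] -/
def lamIn (σ σ' : α → ℝ) (a : α) : List α → ℝ
  | [] => lamBase σ σ' a
  | a' :: _ => lam σ σ' a a'

/-- The outer pairing of a deleted letter `a` with outer neighbour `o` (`none` = the end-point).
[folklore] -/
def lamOut (σ σ' : α → ℝ) (a : α) (b : ℝ) : Option α → ℝ
  | none => lamEnd σ σ' a b
  | some c => lam σ σ' a c

/-- **The derivative sum** over the deletions inside `w`, with prefix `pre` (already traversed
outer letters) and outer neighbour `o` of the head of `w`:
`Σ_{a ∈ w} (Λ_in(a) - Λ_out(a)) · L_{pre ++ (w ∖ a)}(b)`. [folklore] -/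
def Dsum (σ σ' : α → ℝ) (b : ℝ) : List α → Option α → List α → ℝ
  | _, _, [] => 0
  | pre, o, a :: u => (lamIn σ σ' a u - lamOut σ σ' a b o) * hlog σ (pre ++ u) b
      + Dsum σ σ' b (pre ++ [a]) (some a) u

/-- **The derivative of `L_w(b)` in the moving letters** (to be justified): `D_w(b) = Dsum [] none w`.
[folklore] -/
def Dhlog (σ σ' : α → ℝ) (w : List α) (b : ℝ) : ℝ := Dsum σ σ' b [] none w

/-- The `y`-derivative of the density of a moving letter: `∂_y (1/|t-σ_c|) = -σ'_c/(σ_c - t)^2`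
(`σ_c ≥ 1 > t`; `σ'_c = 0` for letters at `0`). [folklore] -/
def dpden (σ σ' : α → ℝ) (c : α) (t : ℝ) : ℝ := -σ' c * pden σ c t ^ 2

variable {σ σ' : α → ℝ} (hσ : ∀ c, σ c = 0 ∨ 1 ≤ σ c) (hZ : ∀ c, σ c = 0 → σ' c = 0)
  (hval : ∀ c c', σ c = σ c' → σ' c = σ' c')
include hσ hZ hval

omit hZ hval in
/-- Partial fractions of two positive densities with distinct poles:
`ρ_c ρ_a = (ε_a ρ_c - ε_c ρ_a)/(σ_c - σ_a)` on `(0,1)`. [folklore] -/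
theorem pden_mul_pden {c a : α} (hne : σ c ≠ σ a) {t : ℝ} (ht : t ∈ Ioo (0 : ℝ) 1) :
    pden σ c t * pden σ a t = (lsign σ a * pden σ c t - lsign σ c * pden σ a t) / (σ c - σ a) := by
  have hsub : σ c - σ a ≠ 0 := sub_ne_zero.2 hne
  have ht0 : t ≠ 0 := ht.1.ne'
  by_cases hc : σ c = 0
  · have ha : σ a ≠ 0 := fun h => hne (hc.trans h.symm)
    have ha1 : 1 ≤ σ a := (hσ a).resolve_left ha
    rw [pden_of_eq_zero (σ := σ) hc ht.1, pden_of_ne_zero hσ ha ht.2, lsign, lsign, if_pos hc, if_neg ha, hc]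
    have : σ a - t ≠ 0 := by linarith [ht.2]
    field_simp
    ring
  · have hc1 : 1 ≤ σ c := (hσ c).resolve_left hc
    by_cases ha : σ a = 0
    · rw [pden_of_eq_zero (σ := σ) ha ht.1, pden_of_ne_zero hσ hc ht.2, lsign, lsign, if_neg hc, if_pos ha, ha]
      have : σ c - t ≠ 0 := by linarith [ht.2]
      field_simp
      ring
    · have ha1 : 1 ≤ σ a := (hσ a).resolve_left ha
      rw [pden_of_ne_zero hσ ha ht.2, pden_of_ne_zero hσ hc ht.2, lsign, lsign, if_neg hc, if_neg ha]
      have h1 : σ c - t ≠ 0 := by linarith [ht.2]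
      have h2 : σ a - t ≠ 0 := by linarith [ht.2]
      field_simp
      ring

/-- **The key identity** behind the derivative formula:
`Λ(c,a) ρ_a - Λ(a,c) ρ_c = (σ'_c - σ'_a) ρ_c ρ_a` on `(0,1)`. [folklore] -/
theorem lam_mul_pden_sub {c a : α} {t : ℝ} (ht : t ∈ Ioo (0 : ℝ) 1) :
    lam σ σ' c a * pden σ a t - lam σ σ' a c * pden σ c t = (σ' c - σ' a) * (pden σ c t * pden σ a t) := by
  by_cases heq : σ c = σ a
  · rw [lam, lam, if_pos heq, if_pos heq.symm, hval c a heq]; ring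
  · have hne' : σ a ≠ σ c := fun h => heq h.symm
    rw [lam, lam, if_neg heq, if_neg hne', pden_mul_pden hσ heq ht]
    have hsub : σ c - σ a ≠ 0 := sub_ne_zero.2 heq
    have hsub' : σ a - σ c ≠ 0 := sub_ne_zero.2 hne'
    by_cases hc : σ c = 0
    · have ha : σ a ≠ 0 := fun h => heq (hc.trans h.symm)
      rw [lsign, lsign, if_pos hc, if_neg ha, hZ c hc]
      field_simp
      ring
    · by_cases ha : σ a = 0
      · rw [lsign, lsign, if_neg hc, if_pos ha, hZ a ha]
        field_simp
        ring
      · rw [lsign, lsign, if_neg hc, if_neg ha]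
        field_simp
        ring

omit hval in
/-- The derivative of the end-point pairing: `∂_b Λ_end(c, b) = -dpden c b`. [folklore] -/
theorem hasDerivAt_lamEnd (c : α) {b : ℝ} (hb : b ∈ Ioo (0 : ℝ) 1) :
    HasDerivAt (lamEnd σ σ' c) (-dpden σ σ' c b) b := by
  unfold lamEnd dpden
  by_cases hc : σ c = 0
  · -- a letter at `0` does not move
    have h0 : σ' c = 0 := hZ c hc
    simp only [h0, zero_mul, neg_zero]
    exact hasDerivAt_const b 0
  · have hc1 : 1 ≤ σ c := (hσ c).resolve_left hc
    have heq : (fun b' => σ' c * pden σ c b') =ᶠ[𝓝 b] fun b' => σ' c * (σ c - b')⁻¹ := by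
      filter_upwards [KZ3.isOpen_Ioo01.mem_nhds hb] with b' hb'
      rw [pden_of_ne_zero hσ hc hb'.2, one_div]
    have hne : σ c - b ≠ 0 := by linarith [hb.2]
    have h1 : HasDerivAt (fun b' => (σ c - b')⁻¹) (-(-1) / (σ c - b) ^ 2) b :=
      ((hasDerivAt_id b).const_sub (σ c)).inv hne |>.congr_deriv (by simp)
    have h : HasDerivAt (fun b' => σ' c * pden σ c b') (σ' c * (-(-1) / (σ c - b) ^ 2)) b :=
      (h1.const_mul (σ' c)).congr_of_eventuallyEq heq
    refine h.congr_deriv ?_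
    rw [pden_of_ne_zero hσ hc hb.2]; field_simp

omit hσ hZ hval in
/-- Regularity at `0` only depends on the last letter. [folklore] -/
theorem isReg_append_iff {l u : List α} (hu : u ≠ []) : IsReg σ (l ++ u) ↔ IsReg σ u := by
  constructor
  · intro h hne
    have := h (by simp [hu])
    rwa [List.getLast_append_of_ne_nil _ hu] at this
  · intro h hne
    rw [List.getLast_append_of_ne_nil _ hu]
    exact h hu

omit hσ hval in
/-- The coefficient of the deletion of the innermost letter vanishes when the new innermost letter
is at `0`. [folklore] -/
theorem lamIn_nil_sub_lam_eq_zero (a c₀ : α) (hc₀ : σ c₀ = 0) :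
    lamIn σ σ' a [] - lam σ σ' a c₀ = 0 := by
  simp only [lamIn, lamBase, lam, hc₀, hZ c₀ hc₀, mul_zero, add_zero, sub_zero]
  split_ifs <;> ring

omit hval in
/-- `b ↦ Dsum (c :: pre ++ [c₀]) (some c₀) u b` differentiates through the outermost letter `c`:
`∂_b = ρ_c(b) · Dsum (pre ++ [c₀]) (some c₀) u b` (all its coefficients are `b`-independent).
[folklore] -/
theorem hasDerivAt_Dsum_cons_prefix (c : α) : ∀ (u : List α), IsReg σ u → ∀ (pre : List α) (c₀ : α)
    {b : ℝ}, b ∈ Ioo (0 : ℝ) 1 →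
    HasDerivAt (fun b => Dsum σ σ' b (c :: (pre ++ [c₀])) (some c₀) u)
      (pden σ c b * Dsum σ σ' b (pre ++ [c₀]) (some c₀) u) b := by
  intro u
  induction u with
  | nil => intro _ pre c₀ b hb; simpa [Dsum] using hasDerivAt_const b (0 : ℝ)
  | cons a u IH =>
    intro hreg pre c₀ b hb
    have IH' := IH (hreg.tail σ) (pre ++ [c₀]) a hb
    have hfun : (fun b => Dsum σ σ' b (c :: (pre ++ [c₀])) (some c₀) (a :: u)) = fun b =>
        (lamIn σ σ' a u - lam σ σ' a c₀) * hlog σ (c :: (pre ++ [c₀] ++ u)) b +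
          Dsum σ σ' b (c :: (pre ++ [c₀] ++ [a])) (some a) u := by
      funext b'; simp [Dsum, lamOut]
    have hval' : pden σ c b * Dsum σ σ' b (pre ++ [c₀]) (some c₀) (a :: u) =
        pden σ c b * ((lamIn σ σ' a u - lam σ σ' a c₀) * hlog σ (pre ++ [c₀] ++ u) b) +
          pden σ c b * Dsum σ σ' b (pre ++ [c₀] ++ [a]) (some a) u := by
      simp [Dsum, lamOut]; ring
    rw [hfun, hval']
    refine HasDerivAt.add ?_ (by simpa using IH')
    -- the first term
    by_cases hdeg : u = [] ∧ σ c₀ = 0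
    · obtain ⟨hu, hc₀⟩ := hdeg
      subst hu
      rw [lamIn_nil_sub_lam_eq_zero hZ a c₀ hc₀]
      simp only [zero_mul, mul_zero]
      exact hasDerivAt_const b 0
    · have hregw : IsReg σ (c :: (pre ++ [c₀] ++ u)) := by
        by_cases hu : u = []
        · subst hu
          have hc₀ : σ c₀ ≠ 0 := fun h => hdeg ⟨rfl, h⟩
          intro hne
          simpa using hc₀
        · have h1 : IsReg σ u := (isReg_cons_of_ne_nil σ hu).1 hreg
          have : c :: (pre ++ [c₀] ++ u) = (c :: (pre ++ [c₀])) ++ u := by simp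
          rw [this]
          exact (isReg_append_iff hu).2 h1
      have h := (hasDerivAt_hlog_cons hσ hregw hb).const_mul (lamIn σ σ' a u - lam σ σ' a c₀)
      refine h.congr_deriv ?_
      simp only [List.append_assoc, List.singleton_append]
      ring

/-- **The derivative sum satisfies the differentiated equation**:
`∂_b D_{cu}(b) = (∂_y ρ_c)(b) L_u(b) + ρ_c(b) D_u(b)` on `(0,1)` — the differential form of the
inductive step of Goncharov's formula (partial fractions and integration by parts become the key
identity `lam_mul_pden_sub`). [folklore] -/
theorem hasDerivAt_Dhlog_cons (c : α) {u : List α} (hu : IsReg σ u) {b : ℝ} (hb : b ∈ Ioo (0 : ℝ) 1) :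
    HasDerivAt (Dhlog σ σ' (c :: u)) (dpden σ σ' c b * hlog σ u b + pden σ c b * Dhlog σ σ' u b) b := by
  cases u with
  | nil =>
    -- `D_{[c]}(b) = Λ_base(c) - Λ_end(c,b)`
    have hfun : Dhlog σ σ' [c] = fun b => (lamBase σ σ' c - lamEnd σ σ' c b) * hlog σ [] b := by
      funext b'; simp [Dhlog, Dsum, lamIn, lamOut]
    rw [hfun]
    have h0 : Dhlog σ σ' ([] : List α) b = 0 := by simp [Dhlog, Dsum]
    rw [h0, mul_zero, add_zero, hlog_nil hσ hb, mul_one]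
    have h1 : HasDerivAt (fun b => lamBase σ σ' c - lamEnd σ σ' c b) (0 - -dpden σ σ' c b) b :=
      (hasDerivAt_const b _).sub (hasDerivAt_lamEnd hσ hZ c hb)
    have heq : (fun b => (lamBase σ σ' c - lamEnd σ σ' c b) * hlog σ [] b) =ᶠ[𝓝 b]
        fun b => lamBase σ σ' c - lamEnd σ σ' c b := by
      filter_upwards [KZ3.isOpen_Ioo01.mem_nhds hb] with b' hb'
      rw [hlog_nil hσ hb', mul_one]
    refine (h1.congr_of_eventuallyEq heq).congr_deriv ?_
    ring
  | cons a u' =>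
    have hu' : IsReg σ u' := hu.tail σ
    -- expand both derivative sums
    have hfun : Dhlog σ σ' (c :: a :: u') = fun b =>
        (lam σ σ' c a - lamEnd σ σ' c b) * hlog σ (a :: u') b +
          ((lamIn σ σ' a u' - lam σ σ' a c) * hlog σ (c :: u') b +
            Dsum σ σ' b ([] ++ [c] ++ [a]) (some a) u') := by
      funext b'; simp [Dhlog, Dsum, lamIn, lamOut]
    have hDu : Dhlog σ σ' (a :: u') b = (lamIn σ σ' a u' - lamEnd σ σ' a b) * hlog σ u' b +
        Dsum σ σ' b ([] ++ [a]) (some a) u' := by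
      simp [Dhlog, Dsum, lamIn, lamOut]
    rw [hfun, hDu]
    -- derivative of the recursive tail through the prefix letter `c`
    have htail : HasDerivAt (fun b => Dsum σ σ' b ([] ++ [c] ++ [a]) (some a) u')
        (pden σ c b * Dsum σ σ' b ([] ++ [a]) (some a) u') b := by
      have h := hasDerivAt_Dsum_cons_prefix hσ hZ c u' hu' [] a hb
      simpa using h
    -- derivative of the first term
    have h1 : HasDerivAt (fun b => (lam σ σ' c a - lamEnd σ σ' c b) * hlog σ (a :: u') b)
        ((0 - -dpden σ σ' c b) * hlog σ (a :: u') b +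
          (lam σ σ' c a - lamEnd σ σ' c b) * (pden σ a b * hlog σ u' b)) b :=
      ((hasDerivAt_const b _).sub (hasDerivAt_lamEnd hσ hZ c hb)).mul (hasDerivAt_hlog_cons hσ hu hb)
    -- derivative of the second term (vanishing coefficient if the word `c u'` is irregular)
    have h2 : HasDerivAt (fun b => (lamIn σ σ' a u' - lam σ σ' a c) * hlog σ (c :: u') b)
        ((lamIn σ σ' a u' - lam σ σ' a c) * (pden σ c b * hlog σ u' b)) b := by
      by_cases hdeg : u' = [] ∧ σ c = 0
      · obtain ⟨hu0, hc⟩ := hdeg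
        subst hu0
        rw [lamIn_nil_sub_lam_eq_zero hZ a c hc]
        simp only [zero_mul]
        exact hasDerivAt_const b 0
      · have hregw : IsReg σ (c :: u') := by
          by_cases hu0 : u' = []
          · subst hu0
            exact (isReg_singleton σ).2 fun h => hdeg ⟨rfl, h⟩
          · exact (isReg_cons_of_ne_nil σ hu0).2 hu'
        exact (hasDerivAt_hlog_cons hσ hregw hb).const_mul _
    refine ((h1.add (h2.add htail)).congr_deriv ?_)
    -- the algebra: the key identity
    have hkey := lam_mul_pden_sub hσ hZ hval (c := c) (a := a) hb
    unfold lamEnd dpden at *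
    have hlin : (lam σ σ' c a - σ' c * pden σ c b) * (pden σ a b * hlog σ u' b) +
        (lamIn σ σ' a u' - lam σ σ' a c) * (pden σ c b * hlog σ u' b) =
        pden σ c b * ((lamIn σ σ' a u' - σ' a * pden σ a b) * hlog σ u' b) := by
      have : (lam σ σ' c a * pden σ a b - lam σ σ' a c * pden σ c b) * hlog σ u' b =
          (σ' c - σ' a) * (pden σ c b * pden σ a b) * hlog σ u' b := by rw [hkey]
      linear_combination this
    linear_combination hlin

/-! ### Bounds and continuity of the derivative sum -/

omit hσ hZ hval in
/-- Bound on the pairing: `|Λ(c,a)| ≤ 2S/δ`. [folklore] -/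
theorem abs_lam_le {c a : α} {S δ : ℝ} (hS : |σ' c| ≤ S) (hS' : |σ' a| ≤ S) (hδ : 0 < δ)
    (hgap : σ c ≠ σ a → δ ≤ |σ c - σ a|) : |lam σ σ' c a| ≤ 2 * S / δ := by
  have hS0 : 0 ≤ S := (abs_nonneg _).trans hS
  unfold lam
  split_ifs with h
  · rw [abs_zero]; positivity
  · rw [abs_div]
    have hg := hgap h
    have hnum : |σ' c + lsign σ c * σ' a| ≤ 2 * S := by
      refine (abs_add_le _ _).trans ?_
      rw [abs_mul]
      have : |lsign σ c| = 1 := by unfold lsign; split_ifs <;> simp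
      rw [this, one_mul]; linarith
    rw [div_le_div_iff₀ (lt_of_lt_of_le hδ hg) hδ]
    nlinarith [abs_nonneg (σ' c + lsign σ c * σ' a)]

omit hZ hval in
/-- Bound on the base pairing: `|Λ_base(c)| ≤ S`. [folklore] -/
theorem abs_lamBase_le {c : α} {S : ℝ} (hS : |σ' c| ≤ S) : |lamBase σ σ' c| ≤ S := by
  have hS0 : 0 ≤ S := (abs_nonneg _).trans hS
  unfold lamBase
  split_ifs with h
  · rw [abs_zero]; exact hS0
  · have h1 : 1 ≤ σ c := (hσ c).resolve_left h
    rw [abs_div, abs_of_pos (show (0 : ℝ) < σ c by linarith)]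
    exact (div_le_self (abs_nonneg _) h1).trans hS

omit hval in
/-- Bound on the end-point pairing: `|Λ_end(c, t)| ≤ S/(1-t)` on `(0,1)`. [folklore] -/
theorem abs_lamEnd_le {c : α} {S : ℝ} (hS : |σ' c| ≤ S) {t : ℝ} (ht : t ∈ Ioo (0 : ℝ) 1) :
    |lamEnd σ σ' c t| ≤ S / (1 - t) := by
  have hS0 : 0 ≤ S := (abs_nonneg _).trans hS
  have h1t : 0 < 1 - t := by linarith [ht.2]
  unfold lamEnd
  by_cases hc : σ c = 0
  · rw [hZ c hc, zero_mul, abs_zero]; positivity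
  · have hc1 : 1 ≤ σ c := (hσ c).resolve_left hc
    have hct : 0 < σ c - t := by linarith [ht.2]
    rw [pden_of_ne_zero hσ hc ht.2, abs_mul, abs_of_pos (one_div_pos.2 hct)]
    calc |σ' c| * (1 / (σ c - t)) ≤ S * (1 / (1 - t)) := by
          refine mul_le_mul hS ?_ (one_div_pos.2 hct).le hS0
          exact one_div_le_one_div_of_le h1t (by linarith)
      _ = S / (1 - t) := by ring

omit hZ hval in
/-- The coefficient of the deletion of a lone letter is `O(t)`:
`|Λ_base(a) - Λ_end(a,t)| ≤ S t/(1-t)` for `σ_a ≠ 0`. [folklore] -/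
theorem abs_lamBase_sub_lamEnd_le {a : α} (ha : σ a ≠ 0) {S : ℝ} (hS : |σ' a| ≤ S) {t : ℝ}
    (ht : t ∈ Ioo (0 : ℝ) 1) : |lamBase σ σ' a - lamEnd σ σ' a t| ≤ S / (1 - t) * t := by
  have ha1 : 1 ≤ σ a := (hσ a).resolve_left ha
  have h1t : 0 < 1 - t := by linarith [ht.2]
  have hat : 0 < σ a - t := by linarith [ht.2]
  unfold lamBase lamEnd
  rw [if_neg ha, pden_of_ne_zero hσ ha ht.2]
  have heq : σ' a / σ a - σ' a * (1 / (σ a - t)) = -(σ' a * (t / (σ a * (σ a - t)))) := by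
    field_simp; ring
  rw [heq, abs_neg, abs_mul]
  have hprod : 1 - t ≤ σ a * (σ a - t) := by
    have := mul_le_mul ha1 (show 1 - t ≤ σ a - t by linarith) h1t.le (by linarith)
    linarith
  have hfrac : |t / (σ a * (σ a - t))| ≤ t / (1 - t) := by
    rw [abs_of_pos (by have := ht.1; positivity)]
    exact div_le_div_of_nonneg_left ht.1.le h1t hprod
  calc |σ' a| * |t / (σ a * (σ a - t))| ≤ S * (t / (1 - t)) :=
        mul_le_mul hS hfrac (abs_nonneg _) ((abs_nonneg _).trans hS)
    _ = S / (1 - t) * t := by ring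

/-- Uniform parameter bounds on a finite set of letters. [folklore] -/
structure PBound (σ σ' : α → ℝ) (L : Finset α) (S δ : ℝ) : Prop where
  deriv_le : ∀ c ∈ L, |σ' c| ≤ S
  gap : ∀ c ∈ L, ∀ a ∈ L, σ c ≠ σ a → δ ≤ |σ c - σ a|
  δ_pos : 0 < δ

/-- The crude coefficient bound `M(t) = 4S/δ + S + S/(1-t)`. [folklore] -/
def Mcoef (S δ t : ℝ) : ℝ := 4 * S / δ + S + S / (1 - t)

omit hval in
/-- `|Λ_in(a,u) - Λ_out(a,t,o)| ≤ M(t)` for letters in the bounded set. [folklore] -/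
theorem abs_lamIn_sub_lamOut_le {L : Finset α} {S δ : ℝ} (hB : PBound σ σ' L S δ) {a : α} (ha : a ∈ L)
    {u : List α} (hu : ∀ x ∈ u, x ∈ L) {o : Option α} (ho : ∀ x ∈ o, x ∈ L) {t : ℝ} (ht : t ∈ Ioo (0 : ℝ) 1) :
    |lamIn σ σ' a u - lamOut σ σ' a t o| ≤ Mcoef S δ t := by
  have hS0 : 0 ≤ S := (abs_nonneg _).trans (hB.deriv_le a ha)
  have h1t : 0 < 1 - t := by linarith [ht.2]
  have hin : |lamIn σ σ' a u| ≤ 2 * S / δ + S := by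
    cases u with
    | nil =>
      simp only [lamIn]
      have := abs_lamBase_le hσ (hB.deriv_le a ha) (σ' := σ')
      have : 0 ≤ 2 * S / δ := by have := hB.δ_pos; positivity
      linarith [abs_lamBase_le hσ (σ' := σ') (hB.deriv_le a ha)]
    | cons a' _ =>
      simp only [lamIn]
      have h := abs_lam_le (σ := σ) (hB.deriv_le a ha) (hB.deriv_le a' (hu a' (by simp))) hB.δ_pos
        (hB.gap a ha a' (hu a' (by simp)))
      linarith
  have hout : |lamOut σ σ' a t o| ≤ 2 * S / δ + S / (1 - t) := by
    cases o with
    | none =>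
      simp only [lamOut]
      have h := abs_lamEnd_le hσ hZ (hB.deriv_le a ha) ht
      have : 0 ≤ 2 * S / δ := by have := hB.δ_pos; positivity
      linarith
    | some c =>
      simp only [lamOut]
      have h := abs_lam_le (σ := σ) (hB.deriv_le a ha) (hB.deriv_le c (ho c rfl)) hB.δ_pos (hB.gap a ha c (ho c rfl))
      have : 0 ≤ S / (1 - t) := by positivity
      linarith
  calc |lamIn σ σ' a u - lamOut σ σ' a t o| ≤ |lamIn σ σ' a u| + |lamOut σ σ' a t o| := abs_sub _ _
    _ ≤ (2 * S / δ + S) + (2 * S / δ + S / (1 - t)) := add_le_add hin hout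
    _ = Mcoef S δ t := by unfold Mcoef; ring

omit hval in
/-- **The derivative sum with a nonempty prefix is `O(t)`**:
`|Dsum (pre ++ [c₀]) (some c₀) w t| ≤ |w| M(t) (2/(1-t))^{|pre|+1+|w|} t`. [folklore] -/
theorem abs_Dsum_le {L : Finset α} {S δ : ℝ} (hB : PBound σ σ' L S δ) : ∀ (w : List α), IsReg σ w →
    (∀ x ∈ w, x ∈ L) → ∀ (pre : List α) (c₀ : α), (∀ x ∈ pre, x ∈ L) → c₀ ∈ L → ∀ {t : ℝ}, t ∈ Ioo (0 : ℝ) 1 →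
    |Dsum σ σ' t (pre ++ [c₀]) (some c₀) w| ≤
      w.length * Mcoef S δ t * (2 / (1 - t)) ^ (pre.length + 1 + w.length) * t := by
  intro w
  induction w with
  | nil => intros; simp [Dsum]
  | cons a u IH =>
    intro hreg hL pre c₀ hpre hc₀ t ht
    have h1t : 0 < 1 - t := by linarith [ht.2]
    have h2 : 1 ≤ 2 / (1 - t) := by rw [le_div_iff₀ h1t]; linarith [ht.1]
    have hM0 : 0 ≤ Mcoef S δ t := le_trans (abs_nonneg _)
      (abs_lamIn_sub_lamOut_le hσ hZ hB (hL a (by simp)) (u := u) (fun x hx => hL x (by simp [hx]))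
        (o := some c₀) (fun x hx => by cases hx; exact hc₀) ht)
    simp only [Dsum]
    have IH' := IH (hreg.tail σ) (fun x hx => hL x (by simp [hx])) (pre ++ [c₀]) a
      (fun x hx => by simp at hx; rcases hx with hx | rfl; exacts [hpre x hx, hc₀]) (hL a (by simp)) ht
    -- the first term
    have hfirst : |(lamIn σ σ' a u - lamOut σ σ' a t (some c₀)) * hlog σ (pre ++ [c₀] ++ u) t| ≤
        Mcoef S δ t * (2 / (1 - t)) ^ (pre.length + 1 + (a :: u).length) * t := by
      by_cases hdeg : u = [] ∧ σ c₀ = 0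
      · obtain ⟨hu, hc⟩ := hdeg
        subst hu
        simp only [lamOut]
        rw [lamIn_nil_sub_lam_eq_zero hZ a c₀ hc, zero_mul, abs_zero]
        have := ht.1.le; positivity
      · have hregw : IsReg σ (pre ++ [c₀] ++ u) := by
          by_cases hu : u = []
          · subst hu; intro hne; simpa using (show σ c₀ ≠ 0 from fun h => hdeg ⟨rfl, h⟩)
          · exact (isReg_append_iff hu).2 ((isReg_cons_of_ne_nil σ hu).1 hreg)
        have hne : pre ++ [c₀] ++ u ≠ [] := by simp
        rw [abs_mul, abs_of_nonneg (hlog_nonneg hσ hregw ht)]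
        have hlen : (pre ++ [c₀] ++ u).length ≤ pre.length + 1 + (a :: u).length := by simp
        calc |lamIn σ σ' a u - lamOut σ σ' a t (some c₀)| * hlog σ (pre ++ [c₀] ++ u) t
            ≤ Mcoef S δ t * ((2 / (1 - t)) ^ (pre ++ [c₀] ++ u).length * t) :=
              mul_le_mul (abs_lamIn_sub_lamOut_le hσ hZ hB (hL a (by simp)) (fun x hx => hL x (by simp [hx]))
                (fun x hx => by cases hx; exact hc₀) ht) (hlog_le_mul hσ hne hregw ht) (hlog_nonneg hσ hregw ht) hM0
          _ ≤ Mcoef S δ t * ((2 / (1 - t)) ^ (pre.length + 1 + (a :: u).length) * t) := by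
              refine mul_le_mul_of_nonneg_left (mul_le_mul_of_nonneg_right (pow_le_pow_right₀ h2 hlen) ht.1.le) hM0
          _ = _ := by ring
    have hlen2 : (pre ++ [c₀]).length + 1 + u.length = pre.length + 1 + (a :: u).length := by simp; omega
    rw [hlen2] at IH'
    calc |(lamIn σ σ' a u - lamOut σ σ' a t (some c₀)) * hlog σ (pre ++ [c₀] ++ u) t +
          Dsum σ σ' t (pre ++ [c₀] ++ [a]) (some a) u|
        ≤ |(lamIn σ σ' a u - lamOut σ σ' a t (some c₀)) * hlog σ (pre ++ [c₀] ++ u) t| +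
          |Dsum σ σ' t (pre ++ [c₀] ++ [a]) (some a) u| := abs_add_le _ _
      _ ≤ Mcoef S δ t * (2 / (1 - t)) ^ (pre.length + 1 + (a :: u).length) * t +
          u.length * Mcoef S δ t * (2 / (1 - t)) ^ (pre.length + 1 + (a :: u).length) * t := add_le_add hfirst IH'
      _ = (a :: u).length * Mcoef S δ t * (2 / (1 - t)) ^ (pre.length + 1 + (a :: u).length) * t := by
          simp; ring

omit hval in
/-- **The derivative sum is `O(t)`**: `|D_u(t)| ≤ |u| M(t) (2/(1-t))^{|u|+1} t` for `u` regular.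
[folklore] -/
theorem abs_Dhlog_le {L : Finset α} {S δ : ℝ} (hB : PBound σ σ' L S δ) {u : List α} (hu : IsReg σ u)
    (hL : ∀ x ∈ u, x ∈ L) {t : ℝ} (ht : t ∈ Ioo (0 : ℝ) 1) :
    |Dhlog σ σ' u t| ≤ u.length * Mcoef S δ t * (2 / (1 - t)) ^ (u.length + 1) * t := by
  cases u with
  | nil => simp [Dhlog, Dsum]
  | cons a u' =>
    have h1t : 0 < 1 - t := by linarith [ht.2]
    have h2 : 1 ≤ 2 / (1 - t) := by rw [le_div_iff₀ h1t]; linarith [ht.1]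
    have ha : a ∈ L := hL a (by simp)
    have hS0 : 0 ≤ S := (abs_nonneg _).trans (hB.deriv_le a ha)
    have hM0 : 0 ≤ Mcoef S δ t := by
      unfold Mcoef; have := hB.δ_pos; positivity
    have hDu : Dhlog σ σ' (a :: u') t = (lamIn σ σ' a u' - lamEnd σ σ' a t) * hlog σ u' t +
        Dsum σ σ' t ([] ++ [a]) (some a) u' := by
      simp [Dhlog, Dsum, lamIn, lamOut]
    rw [hDu]
    have htail := abs_Dsum_le hσ hZ hB u' (hu.tail σ) (fun x hx => hL x (by simp [hx])) [] a (by simp) ha ht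
    have hfirst : |(lamIn σ σ' a u' - lamEnd σ σ' a t) * hlog σ u' t| ≤
        Mcoef S δ t * (2 / (1 - t)) ^ ((a :: u').length + 1) * t := by
      by_cases hu0 : u' = []
      · subst hu0
        have ha0 : σ a ≠ 0 := (isReg_singleton σ).1 hu
        simp only [lamIn]
        rw [hlog_nil hσ ht, mul_one]
        refine (abs_lamBase_sub_lamEnd_le hσ ha0 (hB.deriv_le a ha) ht).trans ?_
        have hM1 : S / (1 - t) ≤ Mcoef S δ t := by
          unfold Mcoef; have := hB.δ_pos; have : 0 ≤ 4 * S / δ := by positivity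
          linarith
        calc S / (1 - t) * t ≤ Mcoef S δ t * 1 * t := by
              rw [mul_one]; exact mul_le_mul_of_nonneg_right hM1 ht.1.le
          _ ≤ Mcoef S δ t * (2 / (1 - t)) ^ ((a :: ([] : List α)).length + 1) * t :=
              mul_le_mul_of_nonneg_right (mul_le_mul_of_nonneg_left (one_le_pow₀ h2) hM0) ht.1.le
      · have hreg' : IsReg σ u' := (isReg_cons_of_ne_nil σ hu0).1 hu
        rw [abs_mul, abs_of_nonneg (hlog_nonneg hσ hreg' ht)]
        have hco : |lamIn σ σ' a u' - lamEnd σ σ' a t| ≤ Mcoef S δ t := by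
          have := abs_lamIn_sub_lamOut_le hσ hZ hB ha (u := u') (fun x hx => hL x (by simp [hx]))
            (o := none) (fun x hx => by cases hx) ht
          simpa [lamOut] using this
        calc |lamIn σ σ' a u' - lamEnd σ σ' a t| * hlog σ u' t
            ≤ Mcoef S δ t * ((2 / (1 - t)) ^ u'.length * t) :=
              mul_le_mul hco (hlog_le_mul hσ hu0 hreg' ht) (hlog_nonneg hσ hreg' ht) hM0
          _ ≤ Mcoef S δ t * ((2 / (1 - t)) ^ ((a :: u').length + 1) * t) := by
              refine mul_le_mul_of_nonneg_left (mul_le_mul_of_nonneg_right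
                (pow_le_pow_right₀ h2 (by simp; omega)) ht.1.le) hM0
          _ = _ := by ring
    have hlen : ([] : List α).length + 1 + u'.length = (a :: u').length := by simp; omega
    rw [hlen] at htail
    have htail' : |Dsum σ σ' t ([] ++ [a]) (some a) u'| ≤
        u'.length * Mcoef S δ t * (2 / (1 - t)) ^ ((a :: u').length + 1) * t := by
      refine htail.trans (mul_le_mul_of_nonneg_right (mul_le_mul_of_nonneg_left
        (pow_le_pow_right₀ h2 (Nat.le_succ _)) (mul_nonneg (Nat.cast_nonneg _) hM0)) ht.1.le)
    calc |(lamIn σ σ' a u' - lamEnd σ σ' a t) * hlog σ u' t + Dsum σ σ' t ([] ++ [a]) (some a) u'|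
        ≤ |(lamIn σ σ' a u' - lamEnd σ σ' a t) * hlog σ u' t| + |Dsum σ σ' t ([] ++ [a]) (some a) u'| :=
          abs_add_le _ _
      _ ≤ Mcoef S δ t * (2 / (1 - t)) ^ ((a :: u').length + 1) * t +
          u'.length * Mcoef S δ t * (2 / (1 - t)) ^ ((a :: u').length + 1) * t := add_le_add hfirst htail'
      _ = (a :: u').length * Mcoef S δ t * (2 / (1 - t)) ^ ((a :: u').length + 1) * t := by simp; ring

omit hval in
/-- Continuity in `b` of the derivative sum with a nonempty prefix. [folklore] -/
theorem continuousOn_Dsum : ∀ (w : List α), IsReg σ w → ∀ (pre : List α) (c₀ : α),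
    ContinuousOn (fun t => Dsum σ σ' t (pre ++ [c₀]) (some c₀) w) (Ioo 0 1) := by
  intro w
  induction w with
  | nil => intro _ pre c₀; simpa [Dsum] using continuousOn_const
  | cons a u IH =>
    intro hreg pre c₀
    simp only [Dsum, lamOut]
    refine ContinuousOn.add ?_ (by simpa using IH (hreg.tail σ) (pre ++ [c₀]) a)
    by_cases hdeg : u = [] ∧ σ c₀ = 0
    · obtain ⟨hu, hc⟩ := hdeg
      subst hu
      rw [lamIn_nil_sub_lam_eq_zero hZ a c₀ hc]
      simpa using continuousOn_const
    · have hregw : IsReg σ (pre ++ [c₀] ++ u) := by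
        by_cases hu : u = []
        · subst hu; intro hne; simpa using (show σ c₀ ≠ 0 from fun h => hdeg ⟨rfl, h⟩)
        · exact (isReg_append_iff hu).2 ((isReg_cons_of_ne_nil σ hu).1 hreg)
      exact continuousOn_const.mul (continuousOn_hlog hσ hregw)

omit hval in
/-- Continuity in `b` of the derivative sum `D_u(b)` for `u` regular. [folklore] -/
theorem continuousOn_Dhlog {u : List α} (hu : IsReg σ u) : ContinuousOn (Dhlog σ σ' u) (Ioo 0 1) := by
  cases u with
  | nil =>
    have : Dhlog σ σ' ([] : List α) = fun _ => 0 := by funext t; simp [Dhlog, Dsum]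
    rw [this]; exact continuousOn_const
  | cons a u' =>
    have hDu : Dhlog σ σ' (a :: u') = fun t => (lamIn σ σ' a u' - lamEnd σ σ' a t) * hlog σ u' t +
        Dsum σ σ' t ([] ++ [a]) (some a) u' := by
      funext t; simp [Dhlog, Dsum, lamIn, lamOut]
    rw [hDu]
    refine ContinuousOn.add ?_ (continuousOn_Dsum hσ hZ u' (hu.tail σ) [] a)
    have hcoef : ContinuousOn (fun t => lamIn σ σ' a u' - lamEnd σ σ' a t) (Ioo 0 1) :=
      continuousOn_const.sub (continuousOn_const.mul (continuousOn_pden hσ a))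
    by_cases hu0 : u' = []
    · subst hu0
      refine (hcoef.mul (continuousOn_const (c := (1 : ℝ)))).congr fun t ht => ?_
      show (lamIn σ σ' a [] - lamEnd σ σ' a t) * hlog σ [] t = (lamIn σ σ' a [] - lamEnd σ σ' a t) * 1
      rw [hlog_nil hσ ht]
    · exact hcoef.mul (continuousOn_hlog hσ ((isReg_cons_of_ne_nil σ hu0).1 hu))

omit hval in
/-- `D_u(t) → 0` as `t → 0⁺` for `u` regular (with letters in a bounded set). [folklore] -/
theorem tendsto_Dhlog_zero {L : Finset α} {S δ : ℝ} (hB : PBound σ σ' L S δ) {u : List α} (hu : IsReg σ u)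
    (hL : ∀ x ∈ u, x ∈ L) : Tendsto (Dhlog σ σ' u) (𝓝[>] 0) (𝓝 0) := by
  by_cases hu0 : u = []
  · subst hu0
    have : Dhlog σ σ' ([] : List α) = fun _ => 0 := by funext t; simp [Dhlog, Dsum]
    rw [this]; exact tendsto_const_nhds
  obtain ⟨a, ha⟩ := List.exists_mem_of_ne_nil u hu0
  have hS0 : 0 ≤ S := (abs_nonneg _).trans (hB.deriv_le a (hL a ha))
  have hδ := hB.δ_pos
  have hhalf : Ioo (0 : ℝ) (1 / 2) ∈ 𝓝[>] (0 : ℝ) := Ioo_mem_nhdsGT (by norm_num)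
  set K : ℝ := u.length * Mcoef S δ (1 / 2) * (2 / (1 - 1 / 2)) ^ (u.length + 1) with hK
  have hlin : Tendsto (fun t : ℝ => K * t) (𝓝[>] 0) (𝓝 (K * 0)) :=
    ((continuous_const.mul continuous_id).tendsto 0).mono_left nhdsWithin_le_nhds
  rw [mul_zero] at hlin
  refine squeeze_zero_norm' ?_ hlin
  filter_upwards [hhalf] with t ht
  have ht1 : t ∈ Ioo (0 : ℝ) 1 := ⟨ht.1, by linarith [ht.2]⟩
  have h1t : 0 < 1 - t := by linarith [ht.2]
  rw [Real.norm_eq_abs]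
  refine (abs_Dhlog_le hσ hZ hB hu hL ht1).trans (mul_le_mul_of_nonneg_right ?_ ht.1.le)
  have hM : Mcoef S δ t ≤ Mcoef S δ (1 / 2) := by
    unfold Mcoef
    have : S / (1 - t) ≤ S / (1 - 1 / 2) :=
      div_le_div_of_nonneg_left hS0 (by norm_num) (by linarith [ht.2])
    linarith
  have hM0 : 0 ≤ Mcoef S δ t := by unfold Mcoef; positivity
  have hp : (2 / (1 - t)) ^ (u.length + 1) ≤ (2 / (1 - 1 / 2)) ^ (u.length + 1) := by
    refine pow_le_pow_left₀ (by positivity) ?_ _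
    exact div_le_div_of_nonneg_left (by norm_num) (by norm_num) (by linarith [ht.2])
  rw [hK]
  exact mul_le_mul (mul_le_mul_of_nonneg_left hM (Nat.cast_nonneg _)) hp (by positivity)
    (mul_nonneg (Nat.cast_nonneg _) (hM0.trans hM))

end DerivSum

/-! ### FTC from the base point -/

section FTC

/-- **FTC from `0⁺`**: if `G' = g` on `(0,1)`, `G(0⁺) = 0` and `g` is integrable on `[0,b]`, then
`∫₀ᵇ g = G(b)`. [folklore] -/
theorem integral_eq_of_hasDerivAt_of_tendsto_zero {G g : ℝ → ℝ} {b : ℝ} (hb : b ∈ Ioo (0 : ℝ) 1)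
    (hG : ∀ t ∈ Ioo (0 : ℝ) 1, HasDerivAt G (g t) t) (h0 : Tendsto G (𝓝[>] 0) (𝓝 0))
    (hint : IntervalIntegrable g volume 0 b) : ∫ t in (0 : ℝ)..b, g t = G b := by
  have hprim : ContinuousOn (fun a => ∫ t in a..b, g t) (uIcc 0 b) :=
    intervalIntegral.continuousOn_primitive_interval_left (by
      rw [uIcc_of_le hb.1.le]; exact (intervalIntegrable_iff_integrableOn_Icc_of_le hb.1.le).1 hint)
  have h0mem : (0 : ℝ) ∈ uIcc 0 b := by rw [uIcc_of_le hb.1.le]; exact ⟨le_rfl, hb.1.le⟩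
  have hlim1 : Tendsto (fun a => ∫ t in a..b, g t) (𝓝[>] 0) (𝓝 (∫ t in (0 : ℝ)..b, g t)) := by
    have h := (hprim 0 h0mem).tendsto
    have hle : 𝓝[>] (0 : ℝ) ≤ 𝓝[uIcc 0 b] 0 := by
      rw [← nhdsWithin_Ioo_eq_nhdsGT hb.1]
      exact nhdsWithin_mono 0 (by rw [uIcc_of_le hb.1.le]; exact Ioo_subset_Icc_self)
    exact h.mono_left hle
  have hlim2 : Tendsto (fun a => G b - G a) (𝓝[>] 0) (𝓝 (G b - 0)) := h0.const_sub _
  rw [sub_zero] at hlim2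
  refine tendsto_nhds_unique hlim1 (hlim2.congr' ?_)
  filter_upwards [Ioo_mem_nhdsGT hb.1] with a ha
  have hsub : uIcc a b ⊆ Ioo 0 1 := by
    rw [uIcc_of_le ha.2.le]; exact fun x hx => ⟨ha.1.trans_le hx.1, hx.2.trans_lt hb.2⟩
  exact (integral_eq_sub_of_hasDerivAt (fun x hx => hG x (hsub hx))
    (hint.mono_set (by rw [uIcc_of_le ha.2.le, uIcc_of_le hb.1.le]; exact Icc_subset_Icc ha.1.le le_rfl))).symm

end FTC

/-! ### One-parameter families of alphabets -/

section Family

variable {σ σ' : ℝ → α → ℝ} {Y : Set ℝ} (hY : IsOpen Y)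
  (hadm : ∀ y ∈ Y, ∀ c, σ y c = 0 ∨ 1 ≤ σ y c)
  (hZc : ∀ c, (∀ y ∈ Y, σ y c = 0) ∨ (∀ y ∈ Y, σ y c ≠ 0))
  (hZd : ∀ y ∈ Y, ∀ c, σ y c = 0 → σ' y c = 0)
  (hinj : ∀ y ∈ Y, ∀ c c', σ y c = σ y c' → c = c')
  (hder : ∀ y ∈ Y, ∀ c, HasDerivAt (fun y => σ y c) (σ' y c) y)
  (hcσ' : ∀ c, ContinuousOn (fun y => σ' y c) Y)
include hY hadm hZc hZd hinj hder hcσ'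

omit hY hadm hZd hinj hder hcσ' in
/-- Regularity of a word does not depend on the parameter. [folklore] -/
theorem isReg_family_iff {y y' : ℝ} (hy : y ∈ Y) (hy' : y' ∈ Y) (w : List α) :
    IsReg (σ y) w ↔ IsReg (σ y') w := by
  constructor <;> intro h hne
  · rcases hZc (w.getLast hne) with hz | hz
    · exact absurd (hz y hy) (h hne)
    · exact hz y' hy'
  · rcases hZc (w.getLast hne) with hz | hz
    · exact absurd (hz y' hy') (h hne)
    · exact hz y hy

omit hadm hZc hZd in
/-- **Uniform parameter bounds near a point** on a finite set of letters. [folklore] -/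
theorem exists_pbound {y₀ : ℝ} (hy₀ : y₀ ∈ Y) (L : Finset α) :
    ∃ S δ : ℝ, ∃ U : Set ℝ, IsOpen U ∧ y₀ ∈ U ∧ U ⊆ Y ∧ ∀ y ∈ U, PBound (σ y) (σ' y) L S δ := by
  classical
  -- derivative bound
  set S : ℝ := ∑ c ∈ L, (|σ' y₀ c| + 1) with hS
  have hS1 : ∀ᶠ y in 𝓝 y₀, ∀ c ∈ L, |σ' y c| ≤ S := by
    have h : ∀ c ∈ L, ∀ᶠ y in 𝓝 y₀, |σ' y c| ≤ |σ' y₀ c| + 1 := by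
      intro c _
      have hc : ContinuousAt (fun y => σ' y c) y₀ := (hcσ' c).continuousAt (hY.mem_nhds hy₀)
      have := hc.norm.eventually (Iio_mem_nhds (by simp : ‖σ' y₀ c‖ < |σ' y₀ c| + 1))
      filter_upwards [this] with y hy
      exact le_of_lt (by simpa using hy)
    filter_upwards [(Finset.eventually_all L).2 h] with y hy c hc
    refine (hy c hc).trans ?_
    rw [hS]
    exact Finset.single_le_sum (f := fun c => |σ' y₀ c| + 1) (fun _ _ => by positivity) hc
  -- gaps
  set P : Finset (α × α) := (L ×ˢ L).filter (fun p => p.1 ≠ p.2) with hP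
  have hgap0 : ∀ p ∈ P, 0 < |σ y₀ p.1 - σ y₀ p.2| := by
    intro p hp
    rw [hP, Finset.mem_filter] at hp
    exact abs_pos.2 (sub_ne_zero.2 fun h => hp.2 (hinj y₀ hy₀ _ _ h))
  obtain ⟨δ, hδ, hδle⟩ : ∃ δ > 0, ∀ p ∈ P, 2 * δ ≤ |σ y₀ p.1 - σ y₀ p.2| := by
    by_cases hPe : P = ∅
    · exact ⟨1, one_pos, by simp [hPe]⟩
    · have hne : P.Nonempty := Finset.nonempty_of_ne_empty hPe
      refine ⟨P.inf' hne (fun p => |σ y₀ p.1 - σ y₀ p.2|) / 2, ?_, fun p hp => ?_⟩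
      · obtain ⟨p, hp, heq⟩ := Finset.exists_mem_eq_inf' hne (fun p => |σ y₀ p.1 - σ y₀ p.2|)
        rw [heq]; exact half_pos (hgap0 p hp)
      · have := Finset.inf'_le (fun p => |σ y₀ p.1 - σ y₀ p.2|) hp
        linarith
  have hS2 : ∀ᶠ y in 𝓝 y₀, ∀ p ∈ P, δ ≤ |σ y p.1 - σ y p.2| := by
    have h : ∀ p ∈ P, ∀ᶠ y in 𝓝 y₀, δ ≤ |σ y p.1 - σ y p.2| := by
      intro p hp
      have hc : ContinuousAt (fun y => σ y p.1 - σ y p.2) y₀ :=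
        ((hder y₀ hy₀ p.1).continuousAt).sub ((hder y₀ hy₀ p.2).continuousAt)
      have h2 := hδle p hp
      have hev := (hc.norm).eventually (Ioi_mem_nhds (show δ < ‖σ y₀ p.1 - σ y₀ p.2‖ by
        rw [Real.norm_eq_abs]; linarith))
      filter_upwards [hev] with y hy
      exact le_of_lt (by simpa using hy)
    exact (Finset.eventually_all P).2 h
  obtain ⟨U, hUsub, hUopen, hUy₀⟩ := mem_nhds_iff.1 (hS1.and (hS2.and (hY.mem_nhds hy₀)))
  refine ⟨S, δ, U, hUopen, hUy₀, fun y hy => (hUsub hy).2.2, fun y hy => ⟨(hUsub hy).1, ?_, hδ⟩⟩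
  intro c hc a ha hne
  have hca : c ≠ a := fun h => hne (by rw [h])
  exact (hUsub hy).2.1 (c, a) (by rw [hP, Finset.mem_filter, Finset.mem_product]; exact ⟨⟨hc, ha⟩, hca⟩)

omit hY hZc hinj hcσ' in
/-- The `y`-derivative of the density of a letter. [folklore] -/
theorem hasDerivAt_pden_family {y : ℝ} (hy : y ∈ Y) {U : Set ℝ} (hU : IsOpen U) (hyU : y ∈ U) (hUY : U ⊆ Y)
    (hZU : ∀ c, (∀ y ∈ U, σ y c = 0) ∨ (∀ y ∈ U, σ y c ≠ 0)) (c : α) {t : ℝ} (ht : t ∈ Ioo (0 : ℝ) 1) :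
    HasDerivAt (fun y => pden (σ y) c t) (dpden (σ y) (σ' y) c t) y := by
  unfold dpden
  rcases hZU c with hz | hz
  · have heq : (fun y' => pden (σ y') c t) =ᶠ[𝓝 y] fun _ => 1 / t := by
      filter_upwards [hU.mem_nhds hyU] with y' hy'
      rw [pden_of_eq_zero (σ := σ y') (hz y' hy') ht.1]
    rw [hZd y hy c (hz y hyU), neg_zero, zero_mul]
    exact (hasDerivAt_const y (1 / t)).congr_of_eventuallyEq heq
  · have heq : (fun y' => pden (σ y') c t) =ᶠ[𝓝 y] fun y' => (σ y' c - t)⁻¹ := by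
      filter_upwards [hU.mem_nhds hyU] with y' hy'
      rw [pden_of_ne_zero (hadm y' (hUY hy')) (hz y' hy') ht.2, one_div]
    have hc1 : 1 ≤ σ y c := (hadm y hy c).resolve_left (hz y hyU)
    have hne : σ y c - t ≠ 0 := by linarith [ht.2]
    have h1 : HasDerivAt (fun y' => (σ y' c - t)⁻¹) (-(σ' y c) / (σ y c - t) ^ 2) y :=
      ((hder y hy c).sub_const t).inv hne
    refine (h1.congr_of_eventuallyEq heq).congr_deriv ?_
    rw [pden_of_ne_zero (hadm y hy) (hz y hyU) ht.2]
    field_simp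

/-- **Theorem T1a (Goncharov's formula, positive conventions).** For a one-parameter family of
admissible alphabets and a word `w` regular at `0`, `y ↦ L_w(b; σ_y)` is differentiable with
derivative the deletion sum `D_w(b) = Σ_i L_{w∖i}(b) (Λ(a_i, a_{i-1}) - Λ(a_i, a_{i+1}))`.
[cite: BrownENS2009, §5.1 (dependence on the `σ_i`); Goncharov, Math. Res. Lett. 5 (1998) Thm 2.1] -/
theorem hasDerivAt_hlog_family : ∀ (w : List α), (∀ y ∈ Y, IsReg (σ y) w) →
    ∀ {y₀ : ℝ}, y₀ ∈ Y → ∀ {b : ℝ}, b ∈ Ioo (0 : ℝ) 1 →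
    HasDerivAt (fun y => hlog (σ y) w b) (Dhlog (σ y₀) (σ' y₀) w b) y₀ := by
  intro w
  induction w with
  | nil =>
    intro _ y₀ hy₀ b hb
    have heq : (fun y => hlog (σ y) ([] : List α) b) =ᶠ[𝓝 y₀] fun _ => 1 := by
      filter_upwards [hY.mem_nhds hy₀] with y hy
      exact hlog_nil (hadm y hy) hb
    have h0 : Dhlog (σ y₀) (σ' y₀) ([] : List α) b = 0 := by simp [Dhlog, Dsum]
    rw [h0]
    exact (hasDerivAt_const y₀ (1 : ℝ)).congr_of_eventuallyEq heq
  | cons c u IH =>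
    intro hreg y₀ hy₀ b hb
    classical
    have hregu : ∀ y ∈ Y, IsReg (σ y) u := fun y hy => (hreg y hy).tail _
    -- uniform bounds on an open neighbourhood `U ⊆ Y` of `y₀`
    obtain ⟨S, δ, U, hUo, hy₀U, hUY, hPB⟩ := exists_pbound hY hinj hder hcσ' hy₀ (c :: u).toFinset
    have hZU : ∀ a, (∀ y ∈ U, σ y a = 0) ∨ (∀ y ∈ U, σ y a ≠ 0) := fun a =>
      (hZc a).imp (fun h y hy => h y (hUY hy)) (fun h y hy => h y (hUY hy))
    have hL : ∀ x ∈ c :: u, x ∈ (c :: u).toFinset := fun x hx => List.mem_toFinset.2 hx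
    have hLu : ∀ x ∈ u, x ∈ (c :: u).toFinset := fun x hx => hL x (List.mem_cons_of_mem c hx)
    have hcL : c ∈ (c :: u).toFinset := hL c (by simp)
    -- the integrand and its derivative
    set F : ℝ → ℝ → ℝ := fun y t => pden (σ y) c t * hlog (σ y) u t with hF
    set F' : ℝ → ℝ → ℝ := fun y t => dpden (σ y) (σ' y) c t * hlog (σ y) u t +
      pden (σ y) c t * Dhlog (σ y) (σ' y) u t with hF'
    have h1b : 0 < 1 - b := by linarith [hb.2]
    -- the constant dominating `F'`
    set K : ℝ := S / (1 - b) ^ 2 * (2 / (1 - b)) ^ u.length +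
      (1 + 1 / (1 - b)) * (u.length * Mcoef S δ b * (2 / (1 - b)) ^ (u.length + 1)) with hK
    have hIoc : ∀ t, t ∈ Ι (0 : ℝ) b → t ∈ Ioo (0 : ℝ) 1 ∧ t ≤ b := by
      intro t ht; rw [uIoc_of_le hb.1.le] at ht; exact ⟨⟨ht.1, ht.2.trans_lt hb.2⟩, ht.2⟩
    have hbound : ∀ t, t ∈ Ι (0 : ℝ) b → ∀ y ∈ U, ‖F' y t‖ ≤ K := by
      intro t ht y hy
      obtain ⟨ht1, htb⟩ := hIoc t ht
      have hyY := hUY hy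
      have hB := hPB y hy
      have h1t : 0 < 1 - t := by linarith [ht1.2]
      have hS0 : 0 ≤ S := (abs_nonneg _).trans (hB.deriv_le c hcL)
      have hδ := hB.δ_pos
      have h2t : (2 : ℝ) / (1 - t) ≤ 2 / (1 - b) := div_le_div_of_nonneg_left (by norm_num) h1b (by linarith)
      have h2t0 : 0 ≤ (2 : ℝ) / (1 - t) := by positivity
      rw [hF', Real.norm_eq_abs]
      -- first term
      have hA : |dpden (σ y) (σ' y) c t * hlog (σ y) u t| ≤ S / (1 - b) ^ 2 * (2 / (1 - b)) ^ u.length := by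
        rw [abs_mul, abs_of_nonneg (hlog_nonneg (hadm y hyY) (hregu y hyY) ht1)]
        have hd : |dpden (σ y) (σ' y) c t| ≤ S / (1 - b) ^ 2 := by
          unfold dpden
          by_cases hc0 : σ y c = 0
          · rw [hZd y hyY c hc0]; simp; positivity
          · have hc1 : 1 ≤ σ y c := (hadm y hyY c).resolve_left hc0
            rw [pden_of_ne_zero (hadm y hyY) hc0 ht1.2, abs_mul, abs_neg, abs_pow,
              abs_of_pos (show (0 : ℝ) < 1 / (σ y c - t) from one_div_pos.2 (by linarith [ht1.2])),
              one_div, inv_pow, ← div_eq_mul_inv]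
            refine div_le_div₀ hS0 (hB.deriv_le c hcL) (by positivity) ?_
            exact pow_le_pow_left₀ h1b.le (by linarith) 2
        refine mul_le_mul hd ((hlog_le (hadm y hyY) (hregu y hyY) ht1).trans
          (pow_le_pow_left₀ h2t0 h2t _)) (hlog_nonneg (hadm y hyY) (hregu y hyY) ht1) (by positivity)
      -- second term
      have hBd : |pden (σ y) c t * Dhlog (σ y) (σ' y) u t| ≤
          (1 + 1 / (1 - b)) * (u.length * Mcoef S δ b * (2 / (1 - b)) ^ (u.length + 1)) := by
        rw [abs_mul, abs_of_nonneg (pden_nonneg (σ := σ y) c t ht1)]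
        have hD := abs_Dhlog_le (hadm y hyY) (hZd y hyY) hB (hregu y hyY) hLu ht1
        have hpt : pden (σ y) c t * t ≤ 1 + 1 / (1 - b) := by
          by_cases hc0 : σ y c = 0
          · rw [pden_of_eq_zero (σ := σ y) hc0 ht1.1, one_div, inv_mul_cancel₀ ht1.1.ne']
            have : 0 ≤ 1 / (1 - b) := by positivity
            linarith
          · have hc1 : 1 ≤ σ y c := (hadm y hyY c).resolve_left hc0
            rw [pden_of_ne_zero (hadm y hyY) hc0 ht1.2]
            have hct : 0 < σ y c - t := by linarith [ht1.2]
            calc 1 / (σ y c - t) * t ≤ 1 / (1 - b) * 1 := by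
                  refine mul_le_mul (one_div_le_one_div_of_le h1b (by linarith)) (by linarith [ht1.2])
                    ht1.1.le (by positivity)
              _ ≤ 1 + 1 / (1 - b) := by linarith
        have hM : Mcoef S δ t ≤ Mcoef S δ b := by
          unfold Mcoef
          have : S / (1 - t) ≤ S / (1 - b) := div_le_div_of_nonneg_left hS0 h1b (by linarith)
          linarith
        have hM0 : 0 ≤ Mcoef S δ t := by unfold Mcoef; positivity
        have hMb0 : 0 ≤ Mcoef S δ b := hM0.trans hM
        calc pden (σ y) c t * |Dhlog (σ y) (σ' y) u t|
            ≤ pden (σ y) c t * (u.length * Mcoef S δ t * (2 / (1 - t)) ^ (u.length + 1) * t) :=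
              mul_le_mul_of_nonneg_left hD (pden_nonneg (σ := σ y) c t ht1)
          _ = (pden (σ y) c t * t) * (u.length * Mcoef S δ t * (2 / (1 - t)) ^ (u.length + 1)) := by ring
          _ ≤ (1 + 1 / (1 - b)) * (u.length * Mcoef S δ b * (2 / (1 - b)) ^ (u.length + 1)) := by
              refine mul_le_mul hpt ?_ (by positivity) (by positivity)
              exact mul_le_mul (mul_le_mul_of_nonneg_left hM (Nat.cast_nonneg _))
                (pow_le_pow_left₀ h2t0 h2t _) (by positivity) (by positivity)
      calc |dpden (σ y) (σ' y) c t * hlog (σ y) u t + pden (σ y) c t * Dhlog (σ y) (σ' y) u t|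
          ≤ |dpden (σ y) (σ' y) c t * hlog (σ y) u t| + |pden (σ y) c t * Dhlog (σ y) (σ' y) u t| := abs_add_le _ _
        _ ≤ K := by rw [hK]; exact add_le_add hA hBd
    -- continuity in `t` on `(0,1)` of `F y` and `F' y` for `y ∈ U`
    have hFc : ∀ y ∈ U, ContinuousOn (F y) (Ioo 0 1) := fun y hy =>
      (continuousOn_pden (hadm y (hUY hy)) c).mul (continuousOn_hlog (hadm y (hUY hy)) (hregu y (hUY hy)))
    have hF'c : ∀ y ∈ U, ContinuousOn (F' y) (Ioo 0 1) := by
      intro y hy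
      have hyY := hUY hy
      refine ContinuousOn.add ?_ ((continuousOn_pden (hadm y hyY) c).mul
        (continuousOn_Dhlog (hadm y hyY) (hZd y hyY) (hregu y hyY)))
      refine ContinuousOn.mul ?_ (continuousOn_hlog (hadm y hyY) (hregu y hyY))
      exact continuousOn_const.mul ((continuousOn_pden (hadm y hyY) c).pow 2)
    have hmeas : ∀ y ∈ U, ∀ (G : ℝ → ℝ), ContinuousOn G (Ioo 0 1) →
        AEStronglyMeasurable G (volume.restrict (Ι (0 : ℝ) b)) := by
      intro y _ G hG
      rw [uIoc_of_le hb.1.le]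
      exact (hG.mono fun t ht => ⟨ht.1, ht.2.trans_lt hb.2⟩).aestronglyMeasurable measurableSet_Ioc
    -- differentiation under the integral sign
    have hmain := hasDerivAt_integral_of_dominated_loc_of_deriv_le (μ := volume) (F := F) (F' := F')
      (x₀ := y₀) (a := 0) (b := b) (bound := fun _ => K) (hUo.mem_nhds hy₀U)
      (by filter_upwards [hUo.mem_nhds hy₀U] with y hy; exact hmeas y hy (F y) (hFc y hy))
      (by simpa [hF] using intervalIntegrable_pden_mul_hlog (hadm y₀ hy₀) (hreg y₀ hy₀) hb)
      (hmeas y₀ hy₀U (F' y₀) (hF'c y₀ hy₀U))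
      (Eventually.of_forall hbound) intervalIntegrable_const
      (Eventually.of_forall fun t ht y hy => by
        obtain ⟨ht1, -⟩ := hIoc t ht
        have h1 := hasDerivAt_pden_family hadm hZd hder (hUY hy) hUo hy hUY hZU c ht1
        have h2 := IH hregu (hUY hy) ht1
        exact h1.mul h2)
    obtain ⟨hint', hderiv⟩ := hmain
    -- `L_{cu}(b; σ_y) = ∫₀ᵇ F y` near `y₀`
    have heq : (fun y => hlog (σ y) (c :: u) b) =ᶠ[𝓝 y₀] fun y => ∫ t in (0 : ℝ)..b, F y t := by
      filter_upwards [hUo.mem_nhds hy₀U] with y hy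
      exact hlog_cons (hadm y (hUY hy)) (hreg y (hUY hy)) hb
    refine (hderiv.congr_of_eventuallyEq heq).congr_deriv ?_
    -- `∫₀ᵇ F' y₀ = D_{cu}(b)`
    have hval : ∀ a a', σ y₀ a = σ y₀ a' → σ' y₀ a = σ' y₀ a' := fun a a' h => by rw [hinj y₀ hy₀ a a' h]
    refine integral_eq_of_hasDerivAt_of_tendsto_zero hb (fun t ht => ?_)
      (tendsto_Dhlog_zero (hadm y₀ hy₀) (hZd y₀ hy₀) (hPB y₀ hy₀U) (hreg y₀ hy₀) hL) hint'
    exact hasDerivAt_Dhlog_cons (hadm y₀ hy₀) (hZd y₀ hy₀) hval c (hregu y₀ hy₀) ht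

end Family

end Hyperlog

end Literature.NumberTheory.Transcendental
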